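import Summits.Ventures.HodgeRepro2.T5RotationGenerator
import Mathlib.Analysis.Normed.Algebra.MatrixExponential

/-!
# The rotation group as a matrix exponential: `k(θ) = exp (θ • W)`

`T5Sl2Standard.rotation θ = !![cos θ, sin θ; -sin θ, cos θ]` and `W = !![0, 1; -1, 0]`.
`T5RotationGenerator` showed that `θ ↦ rotation θ` is a one-parameter group with
`rotation' 0 = W`.  Here the remaining [A] sentence of the support map (S4.20, last column) is
closed: `rotation θ` IS the matrix exponential `NormedSpace.exp (θ • W)` (Mathlib's
`NormedSpace.exp` on `Matrix (Fin 2) (Fin 2) ℂ` with its product topology).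

Proof: `W` is diagonalised by `U = !![1, 1; I, -I]`: `W = U * diagonal ![I, -I] * U⁻¹`, so
`exp (θ • W) = U * diagonal ![e^{iθ}, e^{-iθ}] * U⁻¹` (`Matrix.exp_conj`, `Matrix.exp_diagonal`),
and the last product is `rotation θ` by Euler's formula `e^{iθ} = cos θ + i sin θ`.

Blind lane: Mathlib + own prefix only; no sorry; axioms ⊆ {propext, Classical.choice, Quot.sound}.
-/

namespace Summit.Ventures.HodgeRepro2.T5RotationExp

open T5Sl2Standard Complex Matrix

/-- The eigenvector matrix `U = !![1, 1; I, -I]` of `W` (columns `(1, I)` of eigenvalue `I` and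
`(1, -I)` of eigenvalue `-I`) times `V = !![1/2, -I/2; 1/2, I/2]` is `1`. -/
lemma U_mul_V :
    (!![1, 1; I, -I] : Matrix (Fin 2) (Fin 2) ℂ) * !![1 / 2, -I / 2; 1 / 2, I / 2] = 1 := by
  ext i j
  fin_cases i <;> fin_cases j <;> norm_num [Matrix.mul_apply, Fin.sum_univ_two, Complex.ext_iff]

/-- `V * U = 1`. -/
lemma V_mul_U :
    (!![1 / 2, -I / 2; 1 / 2, I / 2] : Matrix (Fin 2) (Fin 2) ℂ) * !![1, 1; I, -I] = 1 := by
  ext i j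
  fin_cases i <;> fin_cases j <;> norm_num [Matrix.mul_apply, Fin.sum_univ_two, Complex.ext_iff]

/-- `U⁻¹ = V`. -/
lemma inv_U :
    (!![1, 1; I, -I] : Matrix (Fin 2) (Fin 2) ℂ)⁻¹ = !![1 / 2, -I / 2; 1 / 2, I / 2] :=
  Matrix.inv_eq_right_inv U_mul_V

/-- `U` is invertible (`det U = -2i ≠ 0`). -/
lemma isUnit_U : IsUnit (!![1, 1; I, -I] : Matrix (Fin 2) (Fin 2) ℂ) := by
  rw [Matrix.isUnit_iff_isUnit_det]
  have h : (!![1, 1; I, -I] : Matrix (Fin 2) (Fin 2) ℂ).det = -2 * I := by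
    norm_num [Matrix.det_fin_two_of, Complex.ext_iff]
  rw [h]
  exact isUnit_iff_ne_zero.mpr (by norm_num [Complex.ext_iff])

/-- The diagonalisation of `W`: `W = U * diagonal ![I, -I] * U⁻¹`. -/
lemma W_eq_conj : W = !![1, 1; I, -I] * diagonal ![I, -I] * (!![1, 1; I, -I])⁻¹ := by
  rw [inv_U, Matrix.diagonal_vec2]
  ext i j
  fin_cases i <;> fin_cases j <;> norm_num [W, Matrix.mul_apply, Fin.sum_univ_two, Complex.ext_iff]

/-- The diagonalisation of `θ • W`: `θ • W = U * diagonal ![θ i, -θ i] * U⁻¹`. -/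
lemma smul_W_eq_conj (θ : ℂ) :
    θ • W = !![1, 1; I, -I] * diagonal ![θ * I, -θ * I] * (!![1, 1; I, -I])⁻¹ := by
  rw [inv_U, Matrix.diagonal_vec2]
  ext i j
  fin_cases i <;> fin_cases j
  · norm_num [W, Matrix.mul_apply, Fin.sum_univ_two, Complex.ext_iff]
  · norm_num [W, Matrix.mul_apply, Fin.sum_univ_two, Complex.ext_iff]
    constructor <;> ring
  · norm_num [W, Matrix.mul_apply, Fin.sum_univ_two, Complex.ext_iff]
    constructor <;> ring
  · norm_num [W, Matrix.mul_apply, Fin.sum_univ_two, Complex.ext_iff]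

/-- The exponential of a diagonal `2 × 2` complex matrix is the diagonal matrix of the
exponentials of the entries (`Matrix.exp_diagonal` + `Complex.exp_eq_exp_ℂ`). -/
lemma exp_diagonal_two (a b : ℂ) :
    NormedSpace.exp (diagonal ![a, b]) = diagonal ![Complex.exp a, Complex.exp b] := by
  rw [Matrix.exp_diagonal]
  congr 1
  ext i
  fin_cases i <;> simp [Complex.exp_eq_exp_ℂ]

/-- **The matrix exponential of `θ • W`** for a complex parameter `θ`:
`exp (θ • W) = !![cos θ, sin θ; -sin θ, cos θ]` (Euler's formula through the diagonalisation). -/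
theorem exp_smul_W_complex (θ : ℂ) :
    NormedSpace.exp (θ • W) = !![Complex.cos θ, Complex.sin θ; -Complex.sin θ, Complex.cos θ] := by
  rw [smul_W_eq_conj, Matrix.exp_conj _ _ isUnit_U, exp_diagonal_two, inv_U]
  have h1 : Complex.exp (θ * I) = Complex.cos θ + Complex.sin θ * I := Complex.exp_mul_I θ
  have h2 : Complex.exp (-θ * I) = Complex.cos θ - Complex.sin θ * I := by
    rw [Complex.exp_mul_I, Complex.cos_neg, Complex.sin_neg]; ring
  rw [h1, h2, Matrix.diagonal_vec2]
  ext i j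
  fin_cases i <;> fin_cases j <;>
    norm_num [Matrix.mul_apply, Fin.sum_univ_two, Complex.ext_iff] <;> constructor <;> ring

/-- **`k(θ) = exp (θ W)`** for real `θ`: `NormedSpace.exp ((θ : ℂ) • W) = rotation θ` — the rotation
group `K_W ∩ H_j¹ = SO(2)` of the support map is the matrix exponential of its infinitesimal
generator `W`. -/
theorem exp_smul_W (θ : ℝ) : NormedSpace.exp ((θ : ℂ) • W) = T5Sl2Standard.rotation θ := by
  rw [exp_smul_W_complex, T5Sl2Standard.rotation, Complex.ofReal_cos, Complex.ofReal_sin]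

/-- The same with the real scalar action on complex matrices: `exp (θ • W) = rotation θ`. -/
theorem exp_real_smul_W (θ : ℝ) : NormedSpace.exp (θ • W) = T5Sl2Standard.rotation θ := by
  have h : (θ • W : Matrix (Fin 2) (Fin 2) ℂ) = (θ : ℂ) • W := by
    ext i j
    simp [Matrix.smul_apply, Complex.real_smul]
  rw [h, exp_smul_W]

/-- `exp (0 • W) = 1`. -/
theorem exp_smul_W_zero : NormedSpace.exp (((0 : ℝ) : ℂ) • W) = 1 := by
  rw [exp_smul_W, T5RotationGenerator.rotationC_zero]

/-- `θ ↦ exp (θ • W)` is a one-parameter group: `exp ((θ + φ) • W) = exp (θ • W) * exp (φ • W)`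
(from `T5RotationGenerator.rotationC_mul` through the identification). -/
theorem exp_smul_W_add (θ φ : ℝ) :
    NormedSpace.exp (((θ + φ : ℝ) : ℂ) • W) =
      NormedSpace.exp ((θ : ℂ) • W) * NormedSpace.exp ((φ : ℂ) • W) := by
  rw [exp_smul_W, exp_smul_W, exp_smul_W, T5RotationGenerator.rotationC_mul]

/-- `exp (-θ • W) = (exp (θ • W))⁻¹` (`Matrix.exp_neg`). -/
theorem exp_smul_W_neg (θ : ℝ) :
    NormedSpace.exp (((-θ : ℝ) : ℂ) • W) = (NormedSpace.exp ((θ : ℂ) • W))⁻¹ := by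
  rw [← Matrix.exp_neg]
  congr 1
  push_cast
  rw [neg_smul]

/-- The derivative of `θ ↦ exp (θ • W)` at `θ₀` is `exp (θ₀ • W) * W`, entrywise
(`T5RotationGenerator.hasDerivAt_rotationC` through the identification): the one-parameter
group `exp (θ W)` solves `k′ = k W`, `k(0) = 1`. -/
theorem hasDerivAt_exp_smul_W (θ₀ : ℝ) (i j : Fin 2) :
    HasDerivAt (fun θ : ℝ => NormedSpace.exp ((θ : ℂ) • W) i j)
      ((NormedSpace.exp ((θ₀ : ℂ) • W) * W) i j) θ₀ := by
  simp only [exp_smul_W]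
  exact T5RotationGenerator.hasDerivAt_rotationC θ₀ i j

end Summit.Ventures.HodgeRepro2.T5RotationExp
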